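import Mathlib
import Summits.Ventures.PercRepro2.TypedSeries

/-!
# Typed-base reductions V: the leaf rules in the open graph (blind cell PercRepro2, night-3 g2,
2026-08-24; rules (c) and (d) of `proofs/LEAD-TYPED-REDUCTION.md` §1 with pinned-closed side
edges, kernel-checked)

`TypedPendant.lean` proves the unmarked-leaf rule (c) and the pendant-`b` / pendant-`o` rule (d)
for a vertex of degree one IN THE GRAPH. Here the same identities hold when the other edges at the
vertex are merely PINNED CLOSED and untyped (`hcl : ∀ e', e' ≠ f → l ∈ ends e' → e' ∉ F ∧ z e' = false`):
the rules see the graph with the pinned-closed edges deleted.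

* `st_update_closed_unmarked`, `st_update_closed_b`, `st_update_closed_o` — the state identities
  on configurations whose other edges at the vertex are closed (from `conn_update_closed_at_iff`
  and `conn_closed_at_eq`);
* **`typedCount_unmarked_leaf'`**: `N_τ = C(3, τ f) · N_{τ[f := 0]}`;
* **`typedCount_pendant_b'`**, **`typedCount_pendant_o'`**: `N_τ = C(2, τ f − 1) · N_{τ[f := 3]}`
  for `τ f ≥ 1` — proved on the support of the count (`typedCount_congr_K_on`,
  `closed_on_support`) with the kernel identities `KB_killB` / `KB_killO` of `TypedPendant.lean`;
* **`typedCount_loop`**: a typed LOOP `f = {u, u}` (as contraction produces them) contributes the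
  factor `C(3, τ f)` — a loop never changes the open graph (`openGraph_update_loop`);
* **`typedCount_root_pair`**: a typed (or pinned-open) edge joining the two roots kills the count
  (the copy carrying it has `a₁ ↔ a₂`, where `K₃` vanishes).
-/

namespace Summit.Ventures.PercRepro2

namespace CovForm

namespace TypedRed

open OneTyped

/-! ## States at an edge whose other edges at the vertex are closed -/

section ClosedStates

open Classical

variable {V : Type*} {E : Type*} [DecidableEq E]

variable (ends : E → Sym2 V) (o a₁ a₂ a₃ b : V)

/-- If every other edge at the unmarked vertex `l` is closed in `ω`, the state does not depend on
the state of `f = {l, u}`. -/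
lemma st_update_closed_unmarked {f : E} {l u : V} (hf : ends f = s(l, u)) (hlu : l ≠ u)
    (hlo : l ≠ o) (hl1 : l ≠ a₁) (hl2 : l ≠ a₂) (hl3 : l ≠ a₃) (hlb : l ≠ b) {ω : Config E}
    (hcl : ∀ e', e' ≠ f → l ∈ ends e' → ω e' = false) (c : Bool) :
    st ends o a₁ a₂ a₃ b (Function.update ω f c) = st ends o a₁ a₂ a₃ b (Function.update ω f false) := by
  have key := fun {x' v' : V} (hx' : x' ≠ l) (hv' : v' ≠ l) =>
    conn_update_closed_at_iff hf hlu hcl c hx' hv'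
  unfold st
  simp only [Prod.mk.injEq]
  exact ⟨decide_eq_decide.mpr (key hl2.symm hl1.symm), decide_eq_decide.mpr (key hl1.symm hlo.symm),
    decide_eq_decide.mpr (key hl2.symm hlo.symm), decide_eq_decide.mpr (key hl1.symm hlb.symm),
    decide_eq_decide.mpr (key hl2.symm hlb.symm), decide_eq_decide.mpr (key hl1.symm hl3.symm),
    decide_eq_decide.mpr (key hl2.symm hl3.symm)⟩

/-- If every other edge at `b` is closed in `ω`, closing `f = {b, u}` isolates `b`. -/
lemma st_update_closed_b {f : E} {u : V} (hf : ends f = s(b, u)) (hbu : b ≠ u) (hbo : b ≠ o)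
    (hb1 : b ≠ a₁) (hb2 : b ≠ a₂) (hb3 : b ≠ a₃) {ω : Config E}
    (hcl : ∀ e', e' ≠ f → b ∈ ends e' → ω e' = false) :
    st ends o a₁ a₂ a₃ b (Function.update ω f false) =
      killB (st ends o a₁ a₂ a₃ b (Function.update ω f true)) := by
  have key := fun {x' v' : V} (hx' : x' ≠ b) (hv' : v' ≠ b) =>
    (conn_update_closed_at_iff hf hbu hcl true hx' hv').symm
  have hcl' : ∀ e', e' ≠ f → b ∈ ends e' → Function.update ω f false e' = false := fun e' he' hb => by
    rw [Function.update_of_ne he']; exact hcl e' he' hb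
  have hF : Function.update ω f false f = false := Function.update_self f false ω
  unfold st killB
  simp only [Prod.mk.injEq]
  refine ⟨decide_eq_decide.mpr (key hb2.symm hb1.symm), decide_eq_decide.mpr (key hb1.symm hbo.symm),
    decide_eq_decide.mpr (key hb2.symm hbo.symm), ?_, ?_,
    decide_eq_decide.mpr (key hb1.symm hb3.symm), decide_eq_decide.mpr (key hb2.symm hb3.symm)⟩
  · exact decide_eq_false fun h => hb1 (conn_closed_at_eq hf hcl' hF (conn_symm h)).symm
  · exact decide_eq_false fun h => hb2 (conn_closed_at_eq hf hcl' hF (conn_symm h)).symm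

/-- If every other edge at `o` is closed in `ω`, closing `f = {o, u}` isolates `o`. -/
lemma st_update_closed_o {f : E} {u : V} (hf : ends f = s(o, u)) (hou : o ≠ u) (ho1 : o ≠ a₁)
    (ho2 : o ≠ a₂) (ho3 : o ≠ a₃) (hob : o ≠ b) {ω : Config E}
    (hcl : ∀ e', e' ≠ f → o ∈ ends e' → ω e' = false) :
    st ends o a₁ a₂ a₃ b (Function.update ω f false) =
      killO (st ends o a₁ a₂ a₃ b (Function.update ω f true)) := by
  have key := fun {x' v' : V} (hx' : x' ≠ o) (hv' : v' ≠ o) =>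
    (conn_update_closed_at_iff hf hou hcl true hx' hv').symm
  have hcl' : ∀ e', e' ≠ f → o ∈ ends e' → Function.update ω f false e' = false := fun e' he' ho => by
    rw [Function.update_of_ne he']; exact hcl e' he' ho
  have hF : Function.update ω f false f = false := Function.update_self f false ω
  unfold st killO
  simp only [Prod.mk.injEq]
  refine ⟨decide_eq_decide.mpr (key ho2.symm ho1.symm), ?_, ?_,
    decide_eq_decide.mpr (key ho1.symm hob.symm), decide_eq_decide.mpr (key ho2.symm hob.symm),
    decide_eq_decide.mpr (key ho1.symm ho3.symm), decide_eq_decide.mpr (key ho2.symm ho3.symm)⟩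
  · exact decide_eq_false fun h => ho1 (conn_closed_at_eq hf hcl' hF (conn_symm h)).symm
  · exact decide_eq_false fun h => ho2 (conn_closed_at_eq hf hcl' hF (conn_symm h)).symm

end ClosedStates

/-! ## The leaf rules with pinned-closed side edges -/

section ClosedRules

variable {V : Type*} {E : Type*} [Fintype E] [DecidableEq E] {R : Type*} [Field R]
variable (ends : E → Sym2 V) (o a₁ a₂ a₃ b : V)

omit [Fintype E] in
/-- On the support of the count over `F ∖ {f}` with `f` pinned closed, every edge at `l` other
than `f` that is pinned closed in `z` and not typed is closed. -/
lemma closed_on_support {f : E} {l : V} (F : Finset E) (z : Config E)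
    (hcl : ∀ e', e' ≠ f → l ∈ ends e' → e' ∉ F ∧ z e' = false) (x : Config E)
    (hx : ∀ e, e ∉ F.erase f → x e = Function.update z f false e) :
    ∀ e', e' ≠ f → l ∈ ends e' → x e' = false := by
  intro e' he' hl
  obtain ⟨hF, hz⟩ := hcl e' he' hl
  rw [hx e' (fun h => hF (Finset.mem_of_mem_erase h)), Function.update_of_ne he']
  exact hz

/-- **Unmarked leaf in the open graph (rule (c′))**: a typed edge `f = {l, u}`, `l` carrying no
mark, every other edge at `l` pinned closed: `N_τ = C(3, τ f) · N_{τ[f := 0]}`. -/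
theorem typedCount_unmarked_leaf' {f : E} {l u : V} (hf : ends f = s(l, u)) (hlu : l ≠ u)
    (hlo : l ≠ o) (hl1 : l ≠ a₁) (hl2 : l ≠ a₂) (hl3 : l ≠ a₃) (hlb : l ≠ b) (F : Finset E)
    (hfF : f ∈ F) (z : Config E) (τ : E → ℕ)
    (hcl : ∀ e', e' ≠ f → l ∈ ends e' → e' ∉ F ∧ z e' = false) :
    typedCount F z τ (K3 ends o a₁ a₂ a₃ b : Config E → Config E → Config E → R) =
      (Nat.choose 3 (τ f) : R) *
        typedCount F z (Function.update τ f 0) (K3 ends o a₁ a₂ a₃ b) := by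
  have hinv : ∀ (p q r : Bool), typedCount (F.erase f) (Function.update z f false) τ
      (fun x y w => (K3 ends o a₁ a₂ a₃ b (Function.update x f p) (Function.update y f q)
        (Function.update w f r) : R)) =
      typedCount (F.erase f) (Function.update z f false) τ
        (fun x y w => (K3 ends o a₁ a₂ a₃ b (Function.update x f false) (Function.update y f false)
          (Function.update w f false) : R)) := by
    intro p q r
    refine typedCount_congr_K_on _ _ _ fun x y w hxyw _ => ?_
    have hx := closed_on_support ends F z hcl x fun e he => (hxyw e he).1
    have hy := closed_on_support ends F z hcl y fun e he => (hxyw e he).2.1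
    have hw := closed_on_support ends F z hcl w fun e he => (hxyw e he).2.2
    rw [K3_eq_KB, K3_eq_KB,
      st_update_closed_unmarked ends o a₁ a₂ a₃ b hf hlu hlo hl1 hl2 hl3 hlb hx p,
      st_update_closed_unmarked ends o a₁ a₂ a₃ b hf hlu hlo hl1 hl2 hl3 hlb hy q,
      st_update_closed_unmarked ends o a₁ a₂ a₃ b hf hlu hlo hl1 hl2 hl3 hlb hw r]
  rw [typedCount_split F f hfF, typedCount_split_zero F f hfF]
  simp only [hinv]
  exact sum_bool3_choose (τ f) _

/-- **Pendant `b` in the open graph (rule (d′))**: a typed edge `f = {b, u}`, every other edge at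
`b` pinned closed: `N_τ = C(2, τ f − 1) · N_{τ[f := 3]}` for `τ f ≥ 1`. -/
theorem typedCount_pendant_b' {f : E} {u : V} (hf : ends f = s(b, u)) (hbu : b ≠ u) (hbo : b ≠ o)
    (hb1 : b ≠ a₁) (hb2 : b ≠ a₂) (hb3 : b ≠ a₃) (F : Finset E) (hfF : f ∈ F) (z : Config E)
    (τ : E → ℕ) (hτ : 1 ≤ τ f) (hcl : ∀ e', e' ≠ f → b ∈ ends e' → e' ∉ F ∧ z e' = false) :
    typedCount F z τ (K3 ends o a₁ a₂ a₃ b : Config E → Config E → Config E → R) =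
      (Nat.choose 2 (τ f - 1) : R) *
        typedCount F z (Function.update τ f 3) (K3 ends o a₁ a₂ a₃ b) := by
  set S := st ends o a₁ a₂ a₃ b with hS
  set Y : R := typedCount (F.erase f) (Function.update z f false) τ
    (fun x y w => ((KBy (S (Function.update x f true)) (S (Function.update y f true))
      (S (Function.update w f true)) : ℤ) : R)) with hY
  set Z : R := typedCount (F.erase f) (Function.update z f false) τ
    (fun x y w => ((KBz (S (Function.update x f true)) (S (Function.update y f true))
      (S (Function.update w f true)) : ℤ) : R)) with hZ
  have hst : ∀ (x : Config E), (∀ e', e' ≠ f → b ∈ ends e' → x e' = false) → ∀ (p : Bool),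
      S (Function.update x f p) =
        cond p (S (Function.update x f true)) (killB (S (Function.update x f true))) := by
    intro x hx p
    cases p
    · exact st_update_closed_b ends o a₁ a₂ a₃ b hf hbu hbo hb1 hb2 hb3 hx
    · rfl
  have hsplit : ∀ (p q r : Bool), typedCount (F.erase f) (Function.update z f false) τ
      (fun x y w => (K3 ends o a₁ a₂ a₃ b (Function.update x f p) (Function.update y f q)
        (Function.update w f r) : R)) = (if q then Y else 0) + (if r then Z else 0) := by
    intro p q r
    rw [hY, hZ, ← typedCount_ite, ← typedCount_ite, ← typedCount_add]
    refine typedCount_congr_K_on _ _ _ fun x y w hxyw _ => ?_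
    have hx := closed_on_support ends F z hcl x fun e he => (hxyw e he).1
    have hy := closed_on_support ends F z hcl y fun e he => (hxyw e he).2.1
    have hw := closed_on_support ends F z hcl w fun e he => (hxyw e he).2.2
    rw [K3_eq_KB, ← hS, hst x hx p, hst y hy q, hst w hw r, KB_killB]
    push_cast
    cases q <;> cases r <;> simp
  rw [typedCount_split F f hfF]
  simp only [hsplit]
  rw [sum_bool3_pend (τ f) hτ Y Z]
  congr 1
  rw [typedCount_split_three F f hfF, hY, hZ, ← typedCount_add]
  refine typedCount_congr_K _ _ _ fun x y w => ?_
  rw [K3_eq_KB, ← hS, KB_eq_KBy_add_KBz]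
  push_cast
  rfl

/-- **Pendant `o` in the open graph (rule (d′))**: a typed edge `f = {o, u}`, every other edge at
`o` pinned closed: `N_τ = C(2, τ f − 1) · N_{τ[f := 3]}` for `τ f ≥ 1`. -/
theorem typedCount_pendant_o' {f : E} {u : V} (hf : ends f = s(o, u)) (hou : o ≠ u) (ho1 : o ≠ a₁)
    (ho2 : o ≠ a₂) (ho3 : o ≠ a₃) (hob : o ≠ b) (F : Finset E) (hfF : f ∈ F) (z : Config E)
    (τ : E → ℕ) (hτ : 1 ≤ τ f) (hcl : ∀ e', e' ≠ f → o ∈ ends e' → e' ∉ F ∧ z e' = false) :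
    typedCount F z τ (K3 ends o a₁ a₂ a₃ b : Config E → Config E → Config E → R) =
      (Nat.choose 2 (τ f - 1) : R) *
        typedCount F z (Function.update τ f 3) (K3 ends o a₁ a₂ a₃ b) := by
  set S := st ends o a₁ a₂ a₃ b with hS
  set X : R := typedCount (F.erase f) (Function.update z f false) τ
    (fun x y w => ((KOx (S (Function.update x f true)) (S (Function.update y f true))
      (S (Function.update w f true)) : ℤ) : R)) with hX
  set Y : R := typedCount (F.erase f) (Function.update z f false) τ
    (fun x y w => ((KOy (S (Function.update x f true)) (S (Function.update y f true))
      (S (Function.update w f true)) : ℤ) : R)) with hY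
  set Z : R := typedCount (F.erase f) (Function.update z f false) τ
    (fun x y w => ((KOz (S (Function.update x f true)) (S (Function.update y f true))
      (S (Function.update w f true)) : ℤ) : R)) with hZ
  have hst : ∀ (x : Config E), (∀ e', e' ≠ f → o ∈ ends e' → x e' = false) → ∀ (p : Bool),
      S (Function.update x f p) =
        cond p (S (Function.update x f true)) (killO (S (Function.update x f true))) := by
    intro x hx p
    cases p
    · exact st_update_closed_o ends o a₁ a₂ a₃ b hf hou ho1 ho2 ho3 hob hx
    · rfl
  have hsplit : ∀ (p q r : Bool), typedCount (F.erase f) (Function.update z f false) τ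
      (fun x y w => (K3 ends o a₁ a₂ a₃ b (Function.update x f p) (Function.update y f q)
        (Function.update w f r) : R)) =
      (if p then X else 0) + (if q then Y else 0) + (if r then Z else 0) := by
    intro p q r
    rw [hX, hY, hZ, ← typedCount_ite, ← typedCount_ite, ← typedCount_ite, ← typedCount_add,
      ← typedCount_add]
    refine typedCount_congr_K_on _ _ _ fun x y w hxyw _ => ?_
    have hx := closed_on_support ends F z hcl x fun e he => (hxyw e he).1
    have hy := closed_on_support ends F z hcl y fun e he => (hxyw e he).2.1
    have hw := closed_on_support ends F z hcl w fun e he => (hxyw e he).2.2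
    rw [K3_eq_KB, ← hS, hst x hx p, hst y hy q, hst w hw r, KB_killO]
    push_cast
    cases p <;> cases q <;> cases r <;> simp
  rw [typedCount_split F f hfF]
  simp only [hsplit]
  rw [sum_bool3_pend3 (τ f) hτ X Y Z]
  congr 1
  rw [typedCount_split_three F f hfF, hX, hY, hZ, ← typedCount_add, ← typedCount_add]
  refine typedCount_congr_K _ _ _ fun x y w => ?_
  rw [K3_eq_KB, ← hS, KB_eq_KOx_add]
  push_cast
  rfl

end ClosedRules

/-! ## Typed loops -/

section Loops

open Classical

variable {V : Type*} {E : Type*} [DecidableEq E]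

/-- A loop edge never creates an open adjacency between distinct vertices. -/
lemma openGraph_update_loop {ends : E → Sym2 V} {f : E} {u : V} (hf : ends f = s(u, u))
    (ω : Config E) (c : Bool) : openGraph ends (Function.update ω f c) = openGraph ends ω := by
  ext x y
  simp only [openGraph_adj]
  constructor
  · rintro ⟨hne, e, he, hends⟩
    by_cases hef : e = f
    · subst hef
      rw [hf, Sym2.eq_iff] at hends
      rcases hends with ⟨rfl, rfl⟩ | ⟨rfl, rfl⟩ <;> exact absurd rfl hne
    · rw [Function.update_of_ne hef] at he
      exact ⟨hne, e, he, hends⟩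
  · rintro ⟨hne, e, he, hends⟩
    by_cases hef : e = f
    · subst hef
      rw [hf, Sym2.eq_iff] at hends
      rcases hends with ⟨rfl, rfl⟩ | ⟨rfl, rfl⟩ <;> exact absurd rfl hne
    · refine ⟨hne, e, ?_, hends⟩
      rw [Function.update_of_ne hef]; exact he

/-- The state does not depend on the state of a loop edge. -/
lemma st_update_loop (ends : E → Sym2 V) (o a₁ a₂ a₃ b : V) {f : E} {u : V}
    (hf : ends f = s(u, u)) (x : Config E) (c : Bool) :
    st ends o a₁ a₂ a₃ b (Function.update x f c) = st ends o a₁ a₂ a₃ b x := by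
  have key : ∀ p q : V, Conn ends (Function.update x f c) p q ↔ Conn ends x p q := by
    intro p q
    unfold Conn
    rw [openGraph_update_loop hf]
  unfold st
  simp only [Prod.mk.injEq]
  exact ⟨decide_eq_decide.mpr (key _ _), decide_eq_decide.mpr (key _ _),
    decide_eq_decide.mpr (key _ _), decide_eq_decide.mpr (key _ _),
    decide_eq_decide.mpr (key _ _), decide_eq_decide.mpr (key _ _),
    decide_eq_decide.mpr (key _ _)⟩

variable [Fintype E] {R : Type*} [Field R]

/-- **Typed loop**: a typed loop edge `f = {u, u}` contributes the factor `C(3, τ f)`: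
`N_τ = C(3, τ f) · N_{τ[f := 0]}`. -/
theorem typedCount_loop (ends : E → Sym2 V) (o a₁ a₂ a₃ b : V) {f : E} {u : V}
    (hf : ends f = s(u, u)) (F : Finset E) (hfF : f ∈ F) (z : Config E) (τ : E → ℕ) :
    typedCount F z τ (K3 ends o a₁ a₂ a₃ b : Config E → Config E → Config E → R) =
      (Nat.choose 3 (τ f) : R) *
        typedCount F z (Function.update τ f 0) (K3 ends o a₁ a₂ a₃ b) := by
  have hinv : ∀ (p q r : Bool), typedCount (F.erase f) (Function.update z f false) τ
      (fun x y w => (K3 ends o a₁ a₂ a₃ b (Function.update x f p) (Function.update y f q)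
        (Function.update w f r) : R)) =
      typedCount (F.erase f) (Function.update z f false) τ
        (fun x y w => (K3 ends o a₁ a₂ a₃ b (Function.update x f false) (Function.update y f false)
          (Function.update w f false) : R)) := by
    intro p q r
    refine typedCount_congr_K _ _ _ fun x y w => ?_
    rw [K3_eq_KB, K3_eq_KB, st_update_loop ends o a₁ a₂ a₃ b hf x p, st_update_loop ends o a₁ a₂ a₃ b hf y q,
      st_update_loop ends o a₁ a₂ a₃ b hf w r, st_update_loop ends o a₁ a₂ a₃ b hf x false,
      st_update_loop ends o a₁ a₂ a₃ b hf y false, st_update_loop ends o a₁ a₂ a₃ b hf w false]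
  rw [typedCount_split F f hfF, typedCount_split_zero F f hfF]
  simp only [hinv]
  exact sum_bool3_choose (τ f) _

end Loops

/-! ## A typed edge between the two roots -/

section RootPair

open Classical

variable {V : Type*} {E : Type*} [Fintype E] [DecidableEq E] {R : Type*} [Field R]

/-- **Root pair (rule (f))**: a typed (or pinned-open) edge joining the two roots kills every typed
triple — the copy carrying it has `a₁ ↔ a₂`, where the kernel vanishes (`KB_eq_zero_of_q'`). -/
theorem typedCount_root_pair (ends : E → Sym2 V) (o a₁ a₂ a₃ b : V) {f : E}
    (hf : ends f = s(a₁, a₂)) (F : Finset E) (hfF : f ∈ F) (z : Config E) (τ : E → ℕ)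
    (hτ : 1 ≤ τ f) :
    typedCount F z τ (K3 ends o a₁ a₂ a₃ b : Config E → Config E → Config E → R) = 0 := by
  have hq : ∀ x : Config E, x f = true → (st ends o a₁ a₂ a₃ b x).q' = true := by
    intro x hx
    show decide (Conn ends x a₂ a₁) = true
    exact decide_eq_true (conn_of_openAdj ⟨f, hx, by rw [hf, Sym2.eq_swap]⟩)
  unfold typedCount
  refine Finset.sum_eq_zero fun x _ => Finset.sum_eq_zero fun y _ => Finset.sum_eq_zero fun w _ => ?_
  split_ifs with h
  · have hc := h.2 f hfF
    have hopen : x f = true ∨ y f = true ∨ w f = true := by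
      unfold openCount at hc
      cases hx : x f <;> cases hy : y f <;> cases hw : w f <;> simp_all
      omega
    rw [K3_eq_KB]
    rcases hopen with hx | hy | hw
    · rw [KB_eq_zero_of_q' _ _ _ (Or.inl (hq x hx))]; simp
    · rw [KB_eq_zero_of_q' _ _ _ (Or.inr (Or.inl (hq y hy)))]; simp
    · rw [KB_eq_zero_of_q' _ _ _ (Or.inr (Or.inr (hq w hw)))]; simp
  · rfl

end RootPair

end TypedRed

end CovForm

end Summit.Ventures.PercRepro2
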